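import Summits.Ventures.Crystal3D.Bulk.GapCorners
import Mathlib.Analysis.SpecialFunctions.Trigonometric.InverseDeriv
import Mathlib.Analysis.Calculus.Deriv.MeanValue
import HarnessLib

/-!
# Calculus of the P-kite corner functions: all three derivatives share the factor `1/√Q`, so the
# monotonicity of ANY linear row along the kite family is the sign of a QUADRATIC

HONEST FRAMING. Part of the venture `Summits/Ventures/Crystal3D` (cell `pub-crystal3d`, phase 2;
seat p2, PROMOTION-AUDIT prep, memo r1.1 A6 (b1): the B-lineage hole-quadrilateral tables `PZ4_I` /
`PZ4_W1`). Pure real analysis (no configuration appears); nothing here asserts anything about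
GAP(1.26); no census number, head, class or grade word moves.

Along the P-kite family at intruder distance `D` (sides `ρ, 60°, 60°, ρ`, `D = 2 cos ρ`), with the
parameter `x = ⟪u_b, p̂⟫ = cos |pb| ∈ [x♭(D), D/2]`, the tree's closed forms
(`IsGapConfig.cos_corner_shell_hole`, `cos_hole_corner` + `kite_diag_relation`, `cos_corner_rhombus`)
make the three corners explicit:
`u_a = arccos ((4x − D)/(√3 √(4 − D²)))`,
`u_p = arccos (((4 + D²)x² − 4Dx + D² − 2)/((4 − D²)(1 − x²)))`,
`u_b = arccos ((5x² − 4Dx + 2D² − 3)/(3(1 − x²)))`.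
With `Q(x) = 3 − D² + 2Dx − 4x²` (`= 3(4 − D²) sin² u_a /4`, a Cayley–Menger-type quantity):
`1 − cos² u_a = 4Q/(3(4 − D²))`, `1 − cos² u_p = 4Q(1 − Dx)²/((4 − D²)²(1 − x²)²)`,
`1 − cos² u_b = 4Q(D − x)²/(9(1 − x²)²)`, and the derivatives in `x` are
**`u_a' = −2/√Q`, `u_p' = 2(D − x)/((1 − x²)√Q)`, `u_b' = 2(1 − Dx)/((1 − x²)√Q)`**
(`hasDerivAt_kiteUa / _kiteUp / _kiteUb`). Hence for a row `F = α u_a + c₂ u_p + c₄ u_b`: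
`F' = 2 q(x)/((1 − x²)√Q)` with the QUADRATIC `q(x) = α x² − (c₂ + c₄ D) x + (c₂ D + c₄ − α)`, and
`F` is monotone on any parameter interval where `q` keeps a sign: **`kiteRow_le_of_quad_nonneg`**
(`q ≥ 0` on `[x₁, x₂]` ⇒ `F(x₁) ≤ F(x₂)`) and **`kiteRow_ge_of_quad_nonpos`** (`q ≤ 0` ⇒
`F(x₂) ≤ F(x₁)`), for `0 < D`, `D² < 2`, `x₁ ≤ x₂ ≤ D/2`, `Q(x₁) > 0` (mean value theorem,
`monotoneOn_of_hasDerivWithinAt_nonneg`). §4: the admissible parameters are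
`x♭(D) ≤ x ≤ D/2` with `x♭(D) = (D − √(6 − 2D²))/3` the flat end (`|ae| = 60°`, the smaller root
of `3x² − 2Dx + D² − 2`, i.e. of `⟪u_a, u_e⟫ = 1/2`): `kite_flat_root`, `kite_flat_le`,
`kite_flat_le_half`, and `Q > 0` there (`kiteQ_pos_of_flat_nonpos`, `kiteQ_pos_of_le`). (Desk
census `HOME/phase2/p2-rows/g18/`: of the 130 rows of each table `PZ4_I` / `PZ4_W1`, `q` keeps a
sign on the whole cell for 115 / 111; the other 15 / 19 have an interior extremum.) The binding
to configurations (the corners of a P-kite ARE these functions of `x = ⟪u_b, p̂⟫`) and the row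
tables are separate files; this file is the calculus only.
-/

noncomputable section

open Real Set

namespace Summit.Ventures.Crystal3D

/-! ## §1 The three cosine arguments: `1 − h²` and `h'` -/

/-- `1 − cos² u_b = 4Q(D − x)²/(9(1 − x²)²)`. [folklore] -/
theorem kite_one_sub_argB_sq (D x : ℝ) (hx : 1 - x ^ 2 ≠ 0) :
    1 - ((5 * x ^ 2 - 4 * D * x + 2 * D ^ 2 - 3) / (3 * (1 - x ^ 2))) ^ 2 =
      4 * (3 - D ^ 2 + 2 * D * x - 4 * x ^ 2) * (D - x) ^ 2 / (9 * (1 - x ^ 2) ^ 2) := by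
  field_simp
  ring

/-- `1 − cos² u_p = 4Q(1 − Dx)²/((4 − D²)²(1 − x²)²)`. [folklore] -/
theorem kite_one_sub_argP_sq (D x : ℝ) (hx : 1 - x ^ 2 ≠ 0) (hD : 4 - D ^ 2 ≠ 0) :
    1 - (((4 + D ^ 2) * x ^ 2 - 4 * D * x + D ^ 2 - 2) / ((4 - D ^ 2) * (1 - x ^ 2))) ^ 2 =
      4 * (3 - D ^ 2 + 2 * D * x - 4 * x ^ 2) * (1 - D * x) ^ 2 /
        ((4 - D ^ 2) ^ 2 * (1 - x ^ 2) ^ 2) := by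
  field_simp
  ring

/-- `1 − cos² u_a = 4Q/(3(4 − D²))`. [folklore] -/
theorem kite_one_sub_argA_sq (D x : ℝ) (hD : 0 < 4 - D ^ 2) :
    1 - ((4 * x - D) / (√3 * √(4 - D ^ 2))) ^ 2 =
      4 * (3 - D ^ 2 + 2 * D * x - 4 * x ^ 2) / (3 * (4 - D ^ 2)) := by
  have hs3 : (√3) ^ 2 = 3 := Real.sq_sqrt (by norm_num)
  have hs4 : (√(4 - D ^ 2)) ^ 2 = 4 - D ^ 2 := Real.sq_sqrt hD.le
  rw [div_pow, mul_pow, hs3, hs4]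
  field_simp
  ring

/-- Derivative of the `u_b` argument: `h_b' = 4(x − D)(1 − Dx)/(3(1 − x²)²)`. [folklore] -/
theorem hasDerivAt_kite_argB (D x : ℝ) (hx : 1 - x ^ 2 ≠ 0) :
    HasDerivAt (fun y : ℝ => (5 * y ^ 2 - 4 * D * y + 2 * D ^ 2 - 3) / (3 * (1 - y ^ 2)))
      (4 * (x - D) * (1 - D * x) / (3 * (1 - x ^ 2) ^ 2)) x := by
  have kite_hasDerivAt_sq : ∀ z : ℝ, HasDerivAt (fun y : ℝ => y ^ 2) (2 * z) z := fun z => by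
    simpa using hasDerivAt_pow 2 z
  have hn' : HasDerivAt (fun y : ℝ => 5 * y ^ 2 - 4 * D * y + (2 * D ^ 2 - 3))
      (5 * (2 * x) - 4 * D * 1 + 0) x :=
    (((kite_hasDerivAt_sq x).const_mul 5).fun_sub ((hasDerivAt_id' x).const_mul (4 * D))).fun_add
      (hasDerivAt_const x (2 * D ^ 2 - 3))
  have e1 : (fun y : ℝ => 5 * y ^ 2 - 4 * D * y + 2 * D ^ 2 - 3) =
      (fun y : ℝ => 5 * y ^ 2 - 4 * D * y + (2 * D ^ 2 - 3)) := by
    funext y; ring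
  have hm : HasDerivAt (fun y : ℝ => 3 * (1 - y ^ 2)) (3 * (0 - 2 * x)) x :=
    ((hasDerivAt_const x (1:ℝ)).fun_sub (kite_hasDerivAt_sq x)).const_mul 3
  have hm0 : (3 : ℝ) * (1 - x ^ 2) ≠ 0 := mul_ne_zero (by norm_num) hx
  have h := (e1 ▸ hn').fun_div hm hm0
  refine h.congr_deriv ?_
  field_simp
  ring

/-- Derivative of the `u_p` argument: `h_p' = 4(x − D)(1 − Dx)/((4 − D²)(1 − x²)²)`. [folklore] -/
theorem hasDerivAt_kite_argP (D x : ℝ) (hx : 1 - x ^ 2 ≠ 0) (hD : 4 - D ^ 2 ≠ 0) :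
    HasDerivAt (fun y : ℝ => ((4 + D ^ 2) * y ^ 2 - 4 * D * y + D ^ 2 - 2) / ((4 - D ^ 2) * (1 - y ^ 2)))
      (4 * (x - D) * (1 - D * x) / ((4 - D ^ 2) * (1 - x ^ 2) ^ 2)) x := by
  have kite_hasDerivAt_sq : ∀ z : ℝ, HasDerivAt (fun y : ℝ => y ^ 2) (2 * z) z := fun z => by
    simpa using hasDerivAt_pow 2 z
  have hn' : HasDerivAt (fun y : ℝ => (4 + D ^ 2) * y ^ 2 - 4 * D * y + (D ^ 2 - 2))
      ((4 + D ^ 2) * (2 * x) - 4 * D * 1 + 0) x :=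
    (((kite_hasDerivAt_sq x).const_mul (4 + D ^ 2)).fun_sub ((hasDerivAt_id' x).const_mul (4 * D))).fun_add
      (hasDerivAt_const x (D ^ 2 - 2))
  have e1 : (fun y : ℝ => (4 + D ^ 2) * y ^ 2 - 4 * D * y + D ^ 2 - 2) =
      (fun y : ℝ => (4 + D ^ 2) * y ^ 2 - 4 * D * y + (D ^ 2 - 2)) := by
    funext y; ring
  have hm : HasDerivAt (fun y : ℝ => (4 - D ^ 2) * (1 - y ^ 2)) ((4 - D ^ 2) * (0 - 2 * x)) x :=
    ((hasDerivAt_const x (1:ℝ)).fun_sub (kite_hasDerivAt_sq x)).const_mul (4 - D ^ 2)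
  have hm0 : (4 - D ^ 2) * (1 - x ^ 2) ≠ 0 := mul_ne_zero hD hx
  have h := (e1 ▸ hn').fun_div hm hm0
  refine h.congr_deriv ?_
  field_simp
  ring

/-- Derivative of the `u_a` argument: `h_a' = 4/(√3 √(4 − D²))`. [folklore] -/
theorem hasDerivAt_kite_argA (D x : ℝ) :
    HasDerivAt (fun y : ℝ => (4 * y - D) / (√3 * √(4 - D ^ 2))) (4 / (√3 * √(4 - D ^ 2))) x := by
  have h1 : HasDerivAt (fun y : ℝ => 4 * y - D) (4 * 1 - 0) x :=
    ((hasDerivAt_id' x).const_mul 4).fun_sub (hasDerivAt_const x D)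
  have h2 := h1.div_const (√3 * √(4 - D ^ 2))
  refine h2.congr_deriv ?_
  ring

/-! ## §2 The corner functions `u_a(x)`, `u_p(x)`, `u_b(x)` and their derivatives -/

/-- **`u_b' = 2(1 − Dx)/((1 − x²)√Q)`** along the kite family (`x² < 1`, `x < D`, `Dx < 1`, `Q > 0`).
[folklore] -/
theorem hasDerivAt_kiteUb (D x : ℝ) (hx : x ^ 2 < 1) (hxD : x < D)
    (hQ : 0 < 3 - D ^ 2 + 2 * D * x - 4 * x ^ 2) :
    HasDerivAt (fun y : ℝ => Real.arccos ((5 * y ^ 2 - 4 * D * y + 2 * D ^ 2 - 3) / (3 * (1 - y ^ 2))))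
      (2 * (1 - D * x) / ((1 - x ^ 2) * √(3 - D ^ 2 + 2 * D * x - 4 * x ^ 2))) x := by
  set Q := 3 - D ^ 2 + 2 * D * x - 4 * x ^ 2 with hQdef
  set h := (5 * x ^ 2 - 4 * D * x + 2 * D ^ 2 - 3) / (3 * (1 - x ^ 2)) with hh
  have hx1 : 1 - x ^ 2 ≠ 0 := by nlinarith
  have hx1' : 0 < 1 - x ^ 2 := by nlinarith
  have hsq : 1 - h ^ 2 = 4 * Q * (D - x) ^ 2 / (9 * (1 - x ^ 2) ^ 2) := kite_one_sub_argB_sq D x hx1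
  have hR : 0 < 2 * √Q * (D - x) / (3 * (1 - x ^ 2)) := by
    have := Real.sqrt_pos.2 hQ
    apply div_pos (mul_pos (mul_pos two_pos this) (by linarith)) (by linarith)
  have hsqrt : √(1 - h ^ 2) = 2 * √Q * (D - x) / (3 * (1 - x ^ 2)) := by
    rw [hsq]
    have e : 4 * Q * (D - x) ^ 2 / (9 * (1 - x ^ 2) ^ 2) = (2 * √Q * (D - x) / (3 * (1 - x ^ 2))) ^ 2 := by
      rw [div_pow, mul_pow, mul_pow, Real.sq_sqrt hQ.le]; ring
    rw [e, Real.sqrt_sq hR.le]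
  have hpos : 0 < 1 - h ^ 2 := by rw [← Real.sqrt_pos, hsqrt]; exact hR
  have h1 : h ≠ -1 := by intro e; rw [e] at hpos; norm_num at hpos
  have h2 : h ≠ 1 := by intro e; rw [e] at hpos; norm_num at hpos
  have hd := (Real.hasDerivAt_arccos h1 h2).comp x (hasDerivAt_kite_argB D x hx1)
  refine hd.congr_deriv ?_
  rw [hsqrt]
  have hsQ : √Q ≠ 0 := (Real.sqrt_pos.2 hQ).ne'
  have hDx' : D - x ≠ 0 := by linarith
  field_simp
  ring

/-- **`u_p' = 2(D − x)/((1 − x²)√Q)`** along the kite family (`x² < 1`, `x < D`, `Dx < 1`, `D² < 4`,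
`Q > 0`). [folklore] -/
theorem hasDerivAt_kiteUp (D x : ℝ) (hx : x ^ 2 < 1) (hDx : D * x < 1) (hD : D ^ 2 < 4)
    (hQ : 0 < 3 - D ^ 2 + 2 * D * x - 4 * x ^ 2) :
    HasDerivAt
      (fun y : ℝ => Real.arccos (((4 + D ^ 2) * y ^ 2 - 4 * D * y + D ^ 2 - 2) / ((4 - D ^ 2) * (1 - y ^ 2))))
      (2 * (D - x) / ((1 - x ^ 2) * √(3 - D ^ 2 + 2 * D * x - 4 * x ^ 2))) x := by
  set Q := 3 - D ^ 2 + 2 * D * x - 4 * x ^ 2 with hQdef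
  set h := ((4 + D ^ 2) * x ^ 2 - 4 * D * x + D ^ 2 - 2) / ((4 - D ^ 2) * (1 - x ^ 2)) with hh
  have hx1 : 1 - x ^ 2 ≠ 0 := by nlinarith
  have hx1' : 0 < 1 - x ^ 2 := by nlinarith
  have hD4 : 4 - D ^ 2 ≠ 0 := by linarith
  have hD4' : 0 < 4 - D ^ 2 := by linarith
  have hsq : 1 - h ^ 2 = 4 * Q * (1 - D * x) ^ 2 / ((4 - D ^ 2) ^ 2 * (1 - x ^ 2) ^ 2) :=
    kite_one_sub_argP_sq D x hx1 hD4
  have hR : 0 < 2 * √Q * (1 - D * x) / ((4 - D ^ 2) * (1 - x ^ 2)) := by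
    have := Real.sqrt_pos.2 hQ
    exact div_pos (mul_pos (mul_pos two_pos this) (by linarith)) (mul_pos hD4' hx1')
  have hsqrt : √(1 - h ^ 2) = 2 * √Q * (1 - D * x) / ((4 - D ^ 2) * (1 - x ^ 2)) := by
    rw [hsq]
    have e : 4 * Q * (1 - D * x) ^ 2 / ((4 - D ^ 2) ^ 2 * (1 - x ^ 2) ^ 2) =
        (2 * √Q * (1 - D * x) / ((4 - D ^ 2) * (1 - x ^ 2))) ^ 2 := by
      rw [div_pow, mul_pow, mul_pow, mul_pow, Real.sq_sqrt hQ.le]; ring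
    rw [e, Real.sqrt_sq hR.le]
  have hpos : 0 < 1 - h ^ 2 := by rw [← Real.sqrt_pos, hsqrt]; exact hR
  have h1 : h ≠ -1 := by intro e; rw [e] at hpos; norm_num at hpos
  have h2 : h ≠ 1 := by intro e; rw [e] at hpos; norm_num at hpos
  have hd := (Real.hasDerivAt_arccos h1 h2).comp x (hasDerivAt_kite_argP D x hx1 hD4)
  refine hd.congr_deriv ?_
  rw [hsqrt]
  have hsQ : √Q ≠ 0 := (Real.sqrt_pos.2 hQ).ne'
  have hDx' : 1 - D * x ≠ 0 := by linarith
  field_simp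
  ring

/-- **`u_a' = −2/√Q`** along the kite family (`D² < 4`, `Q > 0`). [folklore] -/
theorem hasDerivAt_kiteUa (D x : ℝ) (hD : D ^ 2 < 4) (hQ : 0 < 3 - D ^ 2 + 2 * D * x - 4 * x ^ 2) :
    HasDerivAt (fun y : ℝ => Real.arccos ((4 * y - D) / (√3 * √(4 - D ^ 2))))
      (-2 / √(3 - D ^ 2 + 2 * D * x - 4 * x ^ 2)) x := by
  set Q := 3 - D ^ 2 + 2 * D * x - 4 * x ^ 2 with hQdef
  set h := (4 * x - D) / (√3 * √(4 - D ^ 2)) with hh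
  have hD4' : 0 < 4 - D ^ 2 := by linarith
  have hs3 : 0 < √3 := Real.sqrt_pos.2 (by norm_num)
  have hs4 : 0 < √(4 - D ^ 2) := Real.sqrt_pos.2 hD4'
  have hsq : 1 - h ^ 2 = 4 * Q / (3 * (4 - D ^ 2)) := kite_one_sub_argA_sq D x hD4'
  have hR : 0 < 2 * √Q / (√3 * √(4 - D ^ 2)) := by
    have := Real.sqrt_pos.2 hQ
    positivity
  have hsqrt : √(1 - h ^ 2) = 2 * √Q / (√3 * √(4 - D ^ 2)) := by
    rw [hsq]
    have e : 4 * Q / (3 * (4 - D ^ 2)) = (2 * √Q / (√3 * √(4 - D ^ 2))) ^ 2 := by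
      rw [div_pow, mul_pow, mul_pow, Real.sq_sqrt hQ.le, Real.sq_sqrt (by norm_num : (0:ℝ) ≤ 3),
        Real.sq_sqrt hD4'.le]; ring
    rw [e, Real.sqrt_sq hR.le]
  have hpos : 0 < 1 - h ^ 2 := by rw [← Real.sqrt_pos, hsqrt]; exact hR
  have h1 : h ≠ -1 := by intro e; rw [e] at hpos; norm_num at hpos
  have h2 : h ≠ 1 := by intro e; rw [e] at hpos; norm_num at hpos
  have hd := (Real.hasDerivAt_arccos h1 h2).comp x (hasDerivAt_kite_argA D x)
  refine hd.congr_deriv ?_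
  rw [hsqrt]
  have hsQ : √Q ≠ 0 := (Real.sqrt_pos.2 hQ).ne'
  field_simp
  ring

/-! ## §3 A row `α u_a + c₂ u_p + c₄ u_b` is monotone wherever its quadratic `q` keeps a sign -/

/-- `Q` stays positive between a point where it is positive and `x = D/2` (`Q` is concave in `x`,
`Q(D/2) = 3 − D²`): for `D² < 3`, `x₁ ≤ y ≤ D/2` and `0 < Q(x₁)`, `0 < Q(y)`. -/
theorem kiteQ_pos_of_le {D x₁ y : ℝ} (hD3 : D ^ 2 < 3)
    (hQ : 0 < 3 - D ^ 2 + 2 * D * x₁ - 4 * x₁ ^ 2) (h1 : x₁ ≤ y) (h2 : y ≤ D / 2) :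
    0 < 3 - D ^ 2 + 2 * D * y - 4 * y ^ 2 := by
  rcases eq_or_lt_of_le h1 with h | h
  · subst h; exact hQ
  have key : (D / 2 - x₁) * (3 - D ^ 2 + 2 * D * y - 4 * y ^ 2) =
      (D / 2 - y) * (3 - D ^ 2 + 2 * D * x₁ - 4 * x₁ ^ 2) + (y - x₁) * (3 - D ^ 2) +
        4 * ((y - x₁) * (D / 2 - y)) * (D / 2 - x₁) := by
    ring
  have hpos : 0 < D / 2 - x₁ := by linarith
  have t1 : 0 ≤ (D / 2 - y) * (3 - D ^ 2 + 2 * D * x₁ - 4 * x₁ ^ 2) :=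
    mul_nonneg (by linarith) hQ.le
  have t2 : 0 < (y - x₁) * (3 - D ^ 2) := mul_pos (by linarith) (by linarith)
  have t3 : 0 ≤ 4 * ((y - x₁) * (D / 2 - y)) * (D / 2 - x₁) :=
    mul_nonneg (mul_nonneg (by norm_num) (mul_nonneg (by linarith) (by linarith))) hpos.le
  have h' : (D / 2 - x₁) * 0 < (D / 2 - x₁) * (3 - D ^ 2 + 2 * D * y - 4 * y ^ 2) := by
    rw [mul_zero, key]; linarith
  exact lt_of_mul_lt_mul_left h' hpos.le

/-- `Q > 0` at every admissible parameter: `0 ≤ D`, `x ≤ D/2` and `3x² − 2Dx + D² − 2 ≤ 0`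
(i.e. `⟪u_a, u_e⟫ ≤ 1/2`) give `Q(x) ≥ 1/3 > 0` (`3Q + 4(3x² − 2Dx + D² − 2) = 1 + D² − 2Dx`). -/
theorem kiteQ_pos_of_flat_nonpos {D x : ℝ} (hD0 : 0 ≤ D) (hx : x ≤ D / 2)
    (hP : 3 * x ^ 2 - 2 * D * x + D ^ 2 - 2 ≤ 0) : 0 < 3 - D ^ 2 + 2 * D * x - 4 * x ^ 2 := by
  nlinarith [mul_le_mul_of_nonneg_left hx hD0]

/-- **A kite row whose quadratic is `≥ 0` is increasing along the family** (mean value theorem).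
For `0 < D`, `D² < 2`, `x₁ ≤ x₂ ≤ D/2` with `Q(x₁) > 0`, and reals `α, c₂, c₄` whose quadratic
`q(y) = α y² − (c₂ + c₄ D) y + (c₂ D + c₄ − α)` is `≥ 0` on `[x₁, x₂]`, the row
`F = α u_a + c₂ u_p + c₄ u_b` satisfies `F(x₁) ≤ F(x₂)` (`F' = 2q/((1 − y²)√Q) ≥ 0` inside).
[folklore] -/
theorem kiteRow_le_of_quad_nonneg {D α c₂ c₄ x₁ x₂ : ℝ} (hD0 : 0 < D) (hD2 : D ^ 2 < 2)
    (h12 : x₁ ≤ x₂) (hx₂ : x₂ ≤ D / 2) (hQ : 0 < 3 - D ^ 2 + 2 * D * x₁ - 4 * x₁ ^ 2)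
    (hq : ∀ y ∈ Icc x₁ x₂, 0 ≤ α * y ^ 2 - (c₂ + c₄ * D) * y + (c₂ * D + c₄ - α)) :
    α * arccos ((4 * x₁ - D) / (√3 * √(4 - D ^ 2))) +
        c₂ * arccos (((4 + D ^ 2) * x₁ ^ 2 - 4 * D * x₁ + D ^ 2 - 2) /
          ((4 - D ^ 2) * (1 - x₁ ^ 2))) +
        c₄ * arccos ((5 * x₁ ^ 2 - 4 * D * x₁ + 2 * D ^ 2 - 3) / (3 * (1 - x₁ ^ 2))) ≤
      α * arccos ((4 * x₂ - D) / (√3 * √(4 - D ^ 2))) +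
        c₂ * arccos (((4 + D ^ 2) * x₂ ^ 2 - 4 * D * x₂ + D ^ 2 - 2) /
          ((4 - D ^ 2) * (1 - x₂ ^ 2))) +
        c₄ * arccos ((5 * x₂ ^ 2 - 4 * D * x₂ + 2 * D ^ 2 - 3) / (3 * (1 - x₂ ^ 2))) := by
  have hD4 : D ^ 2 < 4 := by linarith
  -- the derivative `2q/((1 − y²)√Q)` at every point of `[x₁, x₂]`
  have hder : ∀ y ∈ Icc x₁ x₂, HasDerivAt
      (fun y : ℝ => α * arccos ((4 * y - D) / (√3 * √(4 - D ^ 2))) +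
        c₂ * arccos (((4 + D ^ 2) * y ^ 2 - 4 * D * y + D ^ 2 - 2) /
          ((4 - D ^ 2) * (1 - y ^ 2))) +
        c₄ * arccos ((5 * y ^ 2 - 4 * D * y + 2 * D ^ 2 - 3) / (3 * (1 - y ^ 2))))
      (2 * (α * y ^ 2 - (c₂ + c₄ * D) * y + (c₂ * D + c₄ - α)) /
        ((1 - y ^ 2) * √(3 - D ^ 2 + 2 * D * y - 4 * y ^ 2))) y := by
    intro y hy
    have hy2 : y ≤ D / 2 := hy.2.trans hx₂
    have hQy := kiteQ_pos_of_le (by linarith) hQ hy.1 hy2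
    have hDy2 : D * y ≤ D * (D / 2) := mul_le_mul_of_nonneg_left hy2 hD0.le
    have hysq : y ^ 2 < 1 := by nlinarith
    have hyD : y < D := by nlinarith
    have hDy : D * y < 1 := by nlinarith
    have h := (((hasDerivAt_kiteUa D y hD4 hQy).const_mul α).add
      ((hasDerivAt_kiteUp D y hysq hDy hD4 hQy).const_mul c₂)).add
      ((hasDerivAt_kiteUb D y hysq hyD hQy).const_mul c₄)
    refine h.congr_deriv ?_
    have hsQ : √(3 - D ^ 2 + 2 * D * y - 4 * y ^ 2) ≠ 0 := (Real.sqrt_pos.2 hQy).ne'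
    have hy1 : 1 - y ^ 2 ≠ 0 := by linarith
    field_simp
    ring
  have hcont : ContinuousOn
      (fun y : ℝ => α * arccos ((4 * y - D) / (√3 * √(4 - D ^ 2))) +
        c₂ * arccos (((4 + D ^ 2) * y ^ 2 - 4 * D * y + D ^ 2 - 2) /
          ((4 - D ^ 2) * (1 - y ^ 2))) +
        c₄ * arccos ((5 * y ^ 2 - 4 * D * y + 2 * D ^ 2 - 3) / (3 * (1 - y ^ 2))))
      (Icc x₁ x₂) :=
    fun y hy => (hder y hy).continuousAt.continuousWithinAt
  have hmono := monotoneOn_of_hasDerivWithinAt_nonneg (convex_Icc x₁ x₂) hcont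
    (fun y hy => (hder y (by rw [interior_Icc] at hy; exact Ioo_subset_Icc_self hy)).hasDerivWithinAt)
    (fun y hy => by
      rw [interior_Icc] at hy
      have hy' : y ∈ Icc x₁ x₂ := Ioo_subset_Icc_self hy
      have hQy := kiteQ_pos_of_le (by linarith) hQ hy'.1 (hy'.2.trans hx₂)
      have hDy2 : D * y ≤ D * (D / 2) := mul_le_mul_of_nonneg_left (hy'.2.trans hx₂) hD0.le
      have hysq : y ^ 2 < 1 := by nlinarith
      exact div_nonneg (mul_nonneg zero_le_two (hq y hy'))
        (mul_pos (by linarith) (Real.sqrt_pos.2 hQy)).le)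
  exact hmono (left_mem_Icc.2 h12) (right_mem_Icc.2 h12) h12

/-- **A kite row whose quadratic is `≤ 0` is decreasing along the family**: under the hypotheses
of `kiteRow_le_of_quad_nonneg` with `q ≤ 0` on `[x₁, x₂]`, `F(x₂) ≤ F(x₁)` (apply the previous
theorem to `−F`). [folklore] -/
theorem kiteRow_ge_of_quad_nonpos {D α c₂ c₄ x₁ x₂ : ℝ} (hD0 : 0 < D) (hD2 : D ^ 2 < 2)
    (h12 : x₁ ≤ x₂) (hx₂ : x₂ ≤ D / 2) (hQ : 0 < 3 - D ^ 2 + 2 * D * x₁ - 4 * x₁ ^ 2)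
    (hq : ∀ y ∈ Icc x₁ x₂, α * y ^ 2 - (c₂ + c₄ * D) * y + (c₂ * D + c₄ - α) ≤ 0) :
    α * arccos ((4 * x₂ - D) / (√3 * √(4 - D ^ 2))) +
        c₂ * arccos (((4 + D ^ 2) * x₂ ^ 2 - 4 * D * x₂ + D ^ 2 - 2) /
          ((4 - D ^ 2) * (1 - x₂ ^ 2))) +
        c₄ * arccos ((5 * x₂ ^ 2 - 4 * D * x₂ + 2 * D ^ 2 - 3) / (3 * (1 - x₂ ^ 2))) ≤
      α * arccos ((4 * x₁ - D) / (√3 * √(4 - D ^ 2))) +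
        c₂ * arccos (((4 + D ^ 2) * x₁ ^ 2 - 4 * D * x₁ + D ^ 2 - 2) /
          ((4 - D ^ 2) * (1 - x₁ ^ 2))) +
        c₄ * arccos ((5 * x₁ ^ 2 - 4 * D * x₁ + 2 * D ^ 2 - 3) / (3 * (1 - x₁ ^ 2))) := by
  have h := kiteRow_le_of_quad_nonneg (α := -α) (c₂ := -c₂) (c₄ := -c₄) hD0 hD2 h12 hx₂ hQ
    (fun y hy => by have := hq y hy; linarith)
  linarith

/-! ## §4 The parameter interval `[x♭(D), D/2]`, `x♭(D) = (D − √(6 − 2D²))/3` (the flat end) -/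

/-- The flat end `x♭(D) = (D − √(6 − 2D²))/3` is a root of `3x² − 2Dx + D² − 2` with `3x♭ ≤ D`
(`D² ≤ 3`). [folklore] -/
theorem kite_flat_root {D : ℝ} (hD3 : D ^ 2 ≤ 3) :
    3 * ((D - √(6 - 2 * D ^ 2)) / 3) ^ 2 - 2 * D * ((D - √(6 - 2 * D ^ 2)) / 3) + D ^ 2 - 2 = 0 ∧
      3 * ((D - √(6 - 2 * D ^ 2)) / 3) ≤ D := by
  have hs := Real.sq_sqrt (show (0:ℝ) ≤ 6 - 2 * D ^ 2 by linarith)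
  have hs0 := Real.sqrt_nonneg (6 - 2 * D ^ 2)
  constructor
  · linear_combination (1 / 3 : ℝ) * hs
  · linarith

/-- Every parameter with `3x² − 2Dx + D² − 2 ≤ 0` (i.e. `⟪u_a, u_e⟫ ≤ 1/2`) lies above the flat
end: `x♭(D) ≤ x` (`3(3x² − 2Dx + D² − 2) = (3x − D)² − (6 − 2D²)`). [folklore] -/
theorem kite_flat_le {D x : ℝ} (hD3 : D ^ 2 ≤ 3) (hP : 3 * x ^ 2 - 2 * D * x + D ^ 2 - 2 ≤ 0) :
    (D - √(6 - 2 * D ^ 2)) / 3 ≤ x := by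
  have hs := Real.sq_sqrt (show (0:ℝ) ≤ 6 - 2 * D ^ 2 by linarith)
  have hs0 := Real.sqrt_nonneg (6 - 2 * D ^ 2)
  by_contra h
  have h' : x < (D - √(6 - 2 * D ^ 2)) / 3 := lt_of_not_ge h
  have h1 : 3 * x - D + √(6 - 2 * D ^ 2) < 0 := by linarith
  have h2 : 3 * x - D - √(6 - 2 * D ^ 2) < 0 := by linarith
  have h3 := mul_pos_of_neg_of_neg h1 h2
  nlinarith [h3, hs]

/-- The flat end lies below the other end: `x♭(D) ≤ D/2` (`0 ≤ D`). [folklore] -/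
theorem kite_flat_le_half {D : ℝ} (hD0 : 0 ≤ D) : (D - √(6 - 2 * D ^ 2)) / 3 ≤ D / 2 := by
  have hs0 := Real.sqrt_nonneg (6 - 2 * D ^ 2)
  linarith

end Summit.Ventures.Crystal3D

end
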